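import Summits.ValiantsHypothesis.ValiantsHypothesis.Theses.BarrierLever
import Literature.Computability.AlgebraicComplexity.ArithCircuitProofs
import Summits.ValiantsHypothesis.ValiantsHypothesis.Theorems.BarrierLeverSuccinctHittingSetsForVPStubRestrict
import HarnessLib

/-!
# Crux `BarrierLever.SuccinctHittingSetsForVP` (stmt-ValiantsHypothesis-14610), line `registered`:
LEVEL COLLAPSE BY PADDING — the crux is equivalent to its first level

**What is proved (unconditional, helper for the crux; it does NOT close the item).** The route's
crux `BarrierLever.SuccinctHittingSetsForVP` is, verbatim, Forbes–Shpilka–Volk's Question 6 over `ℂ`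
in the tree's regime, `Literature.Barriers.ValiantsHypothesis.SuccinctHittingSetsForVP ℂ`:
`∀ a, ∃ b n₀, ∀ n ≥ n₀, IsSuccinctHittingSet (degLEMonomials n) (SmallCircuits ℂ n b) (Distinguishers ℂ n a)`
(for every distinguisher level `a` — size and degree `≤ N^a` in the `N = C(2n,n)` coefficient
variables — some size exponent `b` makes the coefficient vectors of `{f : deg f ≤ n, L(f) ≤ n^b}`
hit every nonzero level-`a` distinguisher, eventually in `n`). We prove

* `succinctHittingSetsForVP_of_levelOne` : Question 6 at the FIRST level `a = 1` only
  (`∃ b n₀, ∀ n ≥ n₀, IsSuccinctHittingSet … (Distinguishers ℂ n 1)`) already implies the crux;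
* `levelOne_of_succinctHittingSetsForVP` : the converse (instantiation `a := 1`);
* `succinctHittingSetsForVP_iff_levelOne` : hence `crux ↔ level one`;
* `stub_levelCollapse` : the same implication with the Literature constant
  `SuccinctHittingSetsForVP ℂ` as conclusion — verbatim the registered stub of the lead's reshaped
  skeleton (`Cruxes/SuccinctHittingSetsForVP/Lines/birth.lean`: composition
  `SuccinctHittingSetsForVP_of := stub_levelCollapse stub_levelOne`).

So FSV Question 6 in the tree's regime is decided entirely at its first level: `poly(N)`-size
distinguishers are no harder to hit succinctly than `N`-size-and-degree ones, and conversely a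
refuter may aim at level one only. The open problem itself (level one = the registered stub
`stub_levelOne` of the line) is untouched here.

**Proof (padding `n ↦ 3n`).** A level-`(a+1)` distinguisher `D` in the `N_n` coefficient variables,
renamed along the zero-padding of exponent vectors `Fin n ↪ Fin 3n` (`LevelOne.mapsTo_pad`,
restricted to the monomial sets), is a level-`a` distinguisher in the `N_{3n} = C(6n,3n)` variables:
`complexity` and `totalDegree` do not grow under `rename` (`complexity_rename_le_holds'`,
`totalDegree_rename_le`) and `C(2n,n)^(a+1) ≤ C(6n,3n)^a` for `a ≥ 1`, `n ≥ 3`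
(`LevelOne.choose_pow_succ_le`, from `C(2n,n) ≤ 4^n` and `16^n ≤ C(6n,3n)`). It is still nonzero
(`rename_injective`), so the level-`a` hypothesis at `3n` variables supplies a hitting
`f' ∈ SmallCircuits ℂ (3n) b`, and the LANDED projection–truncation lemma `stub_restrict`
(Theorems/BarrierLeverSuccinctHittingSetsForVPStubRestrict.lean) shadows `f'` back to
`f ∈ SmallCircuits ℂ n b'` with the same coefficients on the padded monomials, whence
`D(coeff f) = (rename pad D)(coeff f') ≠ 0` (`eval_rename`). Thus level `a ⇒` level `a+1`
(`LevelOne.level_succ`); induction from level one gives every level `≥ 1`, and level `0 ⊆` level `1`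
by monotonicity (`IsSuccinctHittingSet.mono`). Axioms: `propext`, `Classical.choice`, `Quot.sound`.

References: [ForbesShpilkaVolk2018] Def. 1, Def. 3, Thm. 4, Cor. 5, Question 6 (the framework and
the open question); the padding/level bookkeeping is folklore inside that framework.
-/

-- layout Summits/ValiantsHypothesis/ValiantsHypothesis forces the duplicated namespace component
set_option linter.dupNamespace false

namespace Summit.ValiantsHypothesis.ValiantsHypothesis.Theorems.BarrierLever.SuccinctHittingSetsForVP

open Literature.Barriers.ValiantsHypothesis Literature.Computability.AlgebraicComplexity MvPolynomial

namespace LevelOne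

/-- Zero-padding of exponent vectors along `Fin n ↪ Fin n'` (`n ≤ n'`) maps degree-`≤ n` monomials
to degree-`≤ n'` monomials (the degree is preserved, `Finsupp.degree_mapDomain`). [folklore] -/
theorem mapsTo_pad {n n' : ℕ} (h : n ≤ n') :
    Set.MapsTo (Finsupp.mapDomain (Fin.castLE h)) (degLEMonomials n) (degLEMonomials n') := by
  intro m hm
  simp only [degLEMonomials, Set.mem_setOf_eq] at hm ⊢
  rw [Finsupp.degree_mapDomain]
  exact hm.trans h

/-- The restricted padding map `degLEMonomials n → degLEMonomials n'` is injective. [folklore] -/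
theorem restrict_pad_injective {n n' : ℕ} (h : n ≤ n') :
    Function.Injective ((mapsTo_pad h).restrict _ _ _) :=
  (Set.MapsTo.restrict_inj _).2
    ((Finsupp.mapDomain_injective (Fin.castLE_injective h)).injOn)

/-- `6 n ≤ 4 ^ n` for `n ≥ 3`. [folklore] -/
theorem six_mul_le_four_pow {n : ℕ} (hn : 3 ≤ n) : 6 * n ≤ 4 ^ n := by
  induction n, hn using Nat.le_induction with
  | base => norm_num
  | succ k hk ih =>
    have h6 : 6 ≤ 4 ^ k := le_trans (by norm_num : 6 ≤ 4 ^ 3) (Nat.pow_le_pow_right (by norm_num) hk)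
    calc 6 * (k + 1) = 6 * k + 6 := by ring
      _ ≤ 4 ^ k + 4 ^ k := Nat.add_le_add ih h6
      _ ≤ 4 ^ (k + 1) := by rw [pow_succ]; omega

/-- The padding inequality between levels: `C(2n,n)^(a+1) ≤ C(6n,3n)^a` for `a ≥ 1`, `n ≥ 3`
(`C(2n,n) ≤ 4^n`, `(4^n)^(a+1) ≤ (16^n)^a`, and `16^n ≤ C(6n,3n)` from `4^(3n) ≤ 6n · C(6n,3n)` and
`6n ≤ 4^n`). [folklore] -/
theorem choose_pow_succ_le {n a : ℕ} (hn : 3 ≤ n) (ha : 1 ≤ a) :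
    (Nat.choose (2 * n) n) ^ (a + 1) ≤ (Nat.choose (2 * (3 * n)) (3 * n)) ^ a := by
  have h1 : Nat.choose (2 * n) n ≤ 4 ^ n := by
    calc Nat.choose (2 * n) n ≤ 2 ^ (2 * n) := Nat.choose_le_two_pow _ _
      _ = 4 ^ n := by rw [pow_mul]; norm_num
  have h2 : 16 ^ n ≤ Nat.choose (2 * (3 * n)) (3 * n) := by
    have hc := Nat.four_pow_le_two_mul_self_mul_centralBinom (3 * n) (by omega)
    rw [Nat.centralBinom_eq_two_mul_choose] at hc
    have key : (2 * (3 * n)) * 16 ^ n ≤ (2 * (3 * n)) * Nat.choose (2 * (3 * n)) (3 * n) := by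
      calc (2 * (3 * n)) * 16 ^ n = (6 * n) * 16 ^ n := by ring
        _ ≤ 4 ^ n * 16 ^ n := Nat.mul_le_mul_right _ (six_mul_le_four_pow hn)
        _ = 4 ^ (3 * n) := by
            rw [show (16 : ℕ) = 4 ^ 2 by norm_num, ← pow_mul, ← pow_add]
            congr 1; ring
        _ ≤ _ := hc
    exact Nat.le_of_mul_le_mul_left key (by omega)
  calc (Nat.choose (2 * n) n) ^ (a + 1) ≤ (4 ^ n) ^ (a + 1) := Nat.pow_le_pow_left h1 _
    _ ≤ (4 ^ n) ^ (2 * a) := Nat.pow_le_pow_right (by positivity) (by omega)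
    _ = (16 ^ n) ^ a := by
        rw [pow_mul, ← pow_mul 4 n 2, mul_comm n 2, pow_mul]; norm_num
    _ ≤ (Nat.choose (2 * (3 * n)) (3 * n)) ^ a := Nat.pow_le_pow_left h2 _

/-- A level-`(a+1)` distinguisher in the `N_n` coefficient variables, renamed along the padding to
the `N_{3n}` variables, is a level-`a` distinguisher there (`a ≥ 1`, `n ≥ 3`): `complexity` and
`totalDegree` do not grow under `rename`. [cite: ForbesShpilkaVolk2018, Cor. 5] -/
theorem rename_pad_mem_distinguishers {n a : ℕ} (hn : 3 ≤ n) (ha : 1 ≤ a) (h3 : n ≤ 3 * n)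
    {D : MvPolynomial (degLEMonomials n) ℂ} (hD : D ∈ Distinguishers ℂ n (a + 1)) :
    rename ((mapsTo_pad h3).restrict _ _ _) D ∈ Distinguishers ℂ (3 * n) a := by
  simp only [Distinguishers, Set.mem_setOf_eq] at hD ⊢
  exact ⟨(complexity_rename_le_holds' _ D).trans (hD.1.trans (choose_pow_succ_le hn ha)),
    (totalDegree_rename_le _ D).trans (hD.2.trans (choose_pow_succ_le hn ha))⟩

/-- **The padding step `a ⇒ a + 1`** (`a ≥ 1`): if level `a` is hit with size exponent `b` from
`n₀` on, then level `a + 1` is hit with the exponent `b'` of `stub_restrict b` from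
`n₀ + n₁ + 3` on — pad the distinguisher to `3n` variables, hit it there, shadow the hitting
polynomial back with the landed projection–truncation lemma `stub_restrict`.
[cite: ForbesShpilkaVolk2018, Cor. 5 and Question 6] -/
theorem level_succ {a : ℕ} (ha : 1 ≤ a)
    (h : ∃ b n₀ : ℕ, ∀ n : ℕ, n₀ ≤ n →
      IsSuccinctHittingSet (degLEMonomials n) (SmallCircuits ℂ n b) (Distinguishers ℂ n a)) :
    ∃ b n₀ : ℕ, ∀ n : ℕ, n₀ ≤ n →
      IsSuccinctHittingSet (degLEMonomials n) (SmallCircuits ℂ n b) (Distinguishers ℂ n (a + 1)) := by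
  obtain ⟨b, n₀, hb⟩ := h
  obtain ⟨b', n₁, hb'⟩ := stub_restrict b
  refine ⟨b', n₀ + n₁ + 3, fun n hn => ?_⟩
  intro D hD hD0
  have hn3 : 3 ≤ n := by omega
  have h3 : n ≤ 3 * n := by omega
  -- pad the distinguisher to `3n` variables: still level `a`, still nonzero
  have hD' := rename_pad_mem_distinguishers hn3 ha h3 hD
  have hD'0 : rename ((mapsTo_pad h3).restrict _ _ _) D ≠ 0 := fun h0 =>
    hD0 (rename_injective _ (restrict_pad_injective h3) (by rw [h0, map_zero]))
  -- level `a` at `3n` variables hits it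
  obtain ⟨f', hf', hne⟩ := hb (3 * n) (by omega) _ hD' hD'0
  -- shadow `f'` back to `n` variables, degree `≤ n`
  obtain ⟨f, hf, hcoeff⟩ := hb' n (by omega) (3 * n) h3 le_rfl f' hf'
  refine ⟨f, hf, ?_⟩
  have hvec : coeffVector (degLEMonomials n) f =
      coeffVector (degLEMonomials (3 * n)) f' ∘ (mapsTo_pad h3).restrict _ _ _ := by
    funext m
    simp only [coeffVector_apply, Function.comp_apply, Set.MapsTo.val_restrict_apply]
    exact hcoeff m m.2
  rw [hvec, ← eval_rename]
  exact hne

/-- Every level `a ≥ 1` follows from level one (induction on `a` by `level_succ`).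
[cite: ForbesShpilkaVolk2018, Question 6] -/
theorem level_of_levelOne
    (hbase : ∃ b n₀ : ℕ, ∀ n : ℕ, n₀ ≤ n →
      IsSuccinctHittingSet (degLEMonomials n) (SmallCircuits ℂ n b) (Distinguishers ℂ n 1))
    {a : ℕ} (ha : 1 ≤ a) :
    ∃ b n₀ : ℕ, ∀ n : ℕ, n₀ ≤ n →
      IsSuccinctHittingSet (degLEMonomials n) (SmallCircuits ℂ n b) (Distinguishers ℂ n a) := by
  induction a, ha using Nat.le_induction with
  | base => exact hbase
  | succ a ha ih => exact level_succ ha ih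

/-- Level `0` distinguishers (size and degree `≤ 1`) are level-`1` distinguishers.
[cite: ForbesShpilkaVolk2018, Cor. 5] -/
theorem distinguishers_zero_subset_one (n : ℕ) : Distinguishers ℂ n 0 ⊆ Distinguishers ℂ n 1 := by
  intro D hD
  simp only [Distinguishers, Set.mem_setOf_eq, pow_zero, pow_one] at hD ⊢
  have hN : 1 ≤ Nat.choose (2 * n) n := Nat.choose_pos (by omega)
  exact ⟨hD.1.trans hN, hD.2.trans hN⟩

end LevelOne

/-- **LEVEL COLLAPSE (crux ⇐ level one).** Forbes–Shpilka–Volk's Question 6 over `ℂ` in the tree's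
regime — the route's crux `BarrierLever.SuccinctHittingSetsForVP` — follows from its FIRST level
alone: if for some size exponent `b`, eventually in `n`, the coefficient vectors of
`SmallCircuits ℂ n b` hit every nonzero distinguisher of size and degree `≤ N = C(2n,n)`, then for
EVERY level `a` some `b` does the same against size and degree `≤ N^a` (padding `n ↦ 3n`,
`LevelOne.level_succ`, and the projection–truncation lemma `stub_restrict`).
[cite: ForbesShpilkaVolk2018, Question 6] -/
theorem succinctHittingSetsForVP_of_levelOne
    (hbase : ∃ b n₀ : ℕ, ∀ n : ℕ, n₀ ≤ n →
      IsSuccinctHittingSet (degLEMonomials n) (SmallCircuits ℂ n b) (Distinguishers ℂ n 1)) :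
    Summit.ValiantsHypothesis.ValiantsHypothesis.Theses.BarrierLever.SuccinctHittingSetsForVP := by
  unfold Summit.ValiantsHypothesis.ValiantsHypothesis.Theses.BarrierLever.SuccinctHittingSetsForVP
    Literature.Barriers.ValiantsHypothesis.SuccinctHittingSetsForVP
  intro a
  rcases Nat.eq_zero_or_pos a with rfl | ha
  · obtain ⟨b, n₀, hb⟩ := hbase
    exact ⟨b, n₀, fun n hn => (hb n hn).mono le_rfl (LevelOne.distinguishers_zero_subset_one n)⟩
  · exact LevelOne.level_of_levelOne hbase ha

/-- **Registered stub `stub_levelCollapse`** (crux stmt-ValiantsHypothesis-14610, line `registered`,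
the lead's reshaped skeleton `Cruxes/SuccinctHittingSetsForVP/Lines/birth.lean`): LEVEL COLLAPSE in
arrow form — FSV Question 6 at level one implies the Literature constant
`SuccinctHittingSetsForVP ℂ` (Question 6 at every level), to which the route's crux unfolds by `rfl`.
[cite: ForbesShpilkaVolk2018, Question 6] -/
theorem stub_levelCollapse :
    (∃ b n₀ : ℕ, ∀ n : ℕ, n₀ ≤ n →
      IsSuccinctHittingSet (degLEMonomials n) (SmallCircuits ℂ n b) (Distinguishers ℂ n 1)) →
    Literature.Barriers.ValiantsHypothesis.SuccinctHittingSetsForVP ℂ :=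
  succinctHittingSetsForVP_of_levelOne

/-- **Crux ⇒ level one** (instantiation `a := 1`). [cite: ForbesShpilkaVolk2018, Question 6] -/
theorem levelOne_of_succinctHittingSetsForVP
    (h : Summit.ValiantsHypothesis.ValiantsHypothesis.Theses.BarrierLever.SuccinctHittingSetsForVP) :
    ∃ b n₀ : ℕ, ∀ n : ℕ, n₀ ≤ n →
      IsSuccinctHittingSet (degLEMonomials n) (SmallCircuits ℂ n b) (Distinguishers ℂ n 1) :=
  h 1

/-- **The crux is equivalent to its first level**: FSV Question 6 over `ℂ` (regime `d = n`,
`N = C(2n,n)`, distinguisher size and degree `≤ N^a` for every `a`) holds iff it holds for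
distinguishers of size and degree `≤ N` (level `a = 1`). [cite: ForbesShpilkaVolk2018, Question 6] -/
theorem succinctHittingSetsForVP_iff_levelOne :
    Summit.ValiantsHypothesis.ValiantsHypothesis.Theses.BarrierLever.SuccinctHittingSetsForVP ↔
      ∃ b n₀ : ℕ, ∀ n : ℕ, n₀ ≤ n →
        IsSuccinctHittingSet (degLEMonomials n) (SmallCircuits ℂ n b) (Distinguishers ℂ n 1) :=
  ⟨levelOne_of_succinctHittingSetsForVP, succinctHittingSetsForVP_of_levelOne⟩

end Summit.ValiantsHypothesis.ValiantsHypothesis.Theorems.BarrierLever.SuccinctHittingSetsForVP
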